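import Summits.ValiantsHypothesis.ValiantsHypothesis.Theorems.LacunarySymmetroidMatrixDescartesDoorA26WallBubblingTwoPairChainDictionaryB
import Summits.ValiantsHypothesis.ValiantsHypothesis.Theorems.LacunarySymmetroidMatrixDescartesDoorA26WallBubblingChainCeilingTight
import Summits.ValiantsHypothesis.ValiantsHypothesis.Theorems.LacunarySymmetroidMatrixDescartesDoorA26WallBubblingTwoPairClusterRungs

/-!
# Wall bubbling for `DoorA26` — TWO WEYL PAIRS: slot splitting for the classes `2δ₀`, `2δ₁`, `δ₀+δ₁` (part of the two-pair chain)

HONEST FRAMING.  Bookkeeping for obligation (W) `stub_weylFaces` (crux `DoorA26`, stmt-ValiantsHypothesis-19979; OPEN, typed, never asserted), W1 seat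
val-sym-door-p2 g13 (#52c), a slice of the two-pair chain W1 #52 `…TwoPairChain` (split for the 400-line rule): given the cluster-currency rules for the
pure classes (W1 #51) and the three MIXED-CLASS RULES (inputs), the `hsplit` inequality `Σ_c d_c(w) ≤ 2` for the three values `2δ₀`, `2δ₁`, `δ₀+δ₁`, read
through the member dictionary W1 #52a.  Abstract in the clusters: any `C`, `Γ`, `W` with `polar (W c p) (W c q) ≠ 0 ↔ Γ c p q ≠ 0` and `Γ` symmetric.
Def-free; nothing on `DoorA26`, 18050 or VP ≠ VNP.  `--supports stmt-ValiantsHypothesis-19979 --as helper`.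
-/

-- `Summit.ValiantsHypothesis.ValiantsHypothesis.…` repeats a component by the D-0017 layout
-- (single-conjunct summit), which the `dupNamespace` linter flags; the name is mandated.
set_option linter.dupNamespace false

namespace Summit.ValiantsHypothesis.ValiantsHypothesis.Theorems.LacunarySymmetroidMatrixDescartes.WallBubbling

open Finset
open Bubbling (polar)
open scoped BigOperators

/-- **Slot splitting for the pure and mixed classes at a two-Weyl-pair point** (W2's `hsplit`, three values). [this work] -/
theorem twoPair_hsplit_classes (δ0 : Fin 6 → ℝ) (h50 : δ0 5 = δ0 0) (h41 : δ0 4 = δ0 1)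
    (hG : ∀ a b c e : Fin 4, δ0 a.castSucc.castSucc + δ0 b.castSucc.castSucc = δ0 c.castSucc.castSucc + δ0 e.castSucc.castSucc →
      (a = c ∧ b = e) ∨ (a = e ∧ b = c) ∨
        ((((a = 0 ∧ b = 1) ∨ (a = 1 ∧ b = 0)) ∧ ((c = 2 ∧ e = 3) ∨ (c = 3 ∧ e = 2))) ∨
         (((a = 2 ∧ b = 3) ∨ (a = 3 ∧ b = 2)) ∧ ((c = 0 ∧ e = 1) ∨ (c = 1 ∧ e = 0)))) ∨
        ((((a = 0 ∧ b = 2) ∨ (a = 2 ∧ b = 0)) ∧ ((c = 1 ∧ e = 3) ∨ (c = 3 ∧ e = 1))) ∨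
         (((a = 1 ∧ b = 3) ∨ (a = 3 ∧ b = 1)) ∧ ((c = 0 ∧ e = 2) ∨ (c = 2 ∧ e = 0)))))
    {C : ℕ} (Γ : Fin C → Fin 6 → Fin 6 → ℝ) (W : Fin C → Fin 6 → Matrix (Fin 2) (Fin 2) ℝ)
    (hal : ∀ c p q, polar (W c p) (W c q) ≠ 0 ↔ Γ c p q ≠ 0) (hΓsymm : ∀ c a b, Γ c a b = Γ c b a)
    (Rtop05 : ∀ c c' : Fin C, c < c' → Γ c 5 5 ≠ 0 → Γ c' 5 5 = 0 ∧ Γ c' 0 5 = 0)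
    (Rtop14 : ∀ c c' : Fin C, c < c' → Γ c 4 4 ≠ 0 → Γ c' 4 4 = 0 ∧ Γ c' 1 4 = 0)
    (Rmid05 : ∀ c c' : Fin C, c < c' → Γ c 0 5 ≠ 0 → Γ c' 5 5 = 0)
    (Rmid14 : ∀ c c' : Fin C, c < c' → Γ c 1 4 ≠ 0 → Γ c' 4 4 = 0)
    (Rthree05 : ∀ c₁ c₂ c₃ : Fin C, c₁ < c₂ → c₂ < c₃ → Γ c₁ 0 5 ≠ 0 → Γ c₂ 0 5 ≠ 0 → Γ c₃ 0 5 ≠ 0 → False)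
    (Rthree14 : ∀ c₁ c₂ c₃ : Fin C, c₁ < c₂ → c₂ < c₃ → Γ c₁ 1 4 ≠ 0 → Γ c₂ 1 4 ≠ 0 → Γ c₃ 1 4 ≠ 0 → False)
    (Mtop : ∀ c c' : Fin C, c < c' → Γ c 5 4 ≠ 0 → Γ c' 5 4 = 0 ∧ Γ c' 0 4 = 0 ∧ Γ c' 5 1 = 0)
    (Mmid : ∀ c c' : Fin C, c < c' → (Γ c 0 4 ≠ 0 ∨ Γ c 5 1 ≠ 0) → Γ c' 5 4 = 0)
    (Mthree : ∀ c₁ c₂ c₃ : Fin C, c₁ < c₂ → c₂ < c₃ → (Γ c₁ 0 4 ≠ 0 ∨ Γ c₁ 5 1 ≠ 0) → (Γ c₂ 0 4 ≠ 0 ∨ Γ c₂ 5 1 ≠ 0) →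
      (Γ c₃ 0 4 ≠ 0 ∨ Γ c₃ 5 1 ≠ 0) → False) :
    ∀ w : ℝ, (w = δ0 0 + δ0 0 ∨ w = δ0 1 + δ0 1 ∨ w = δ0 0 + δ0 1) →
      (∑ c : Fin C, (if w ∈ ((univ : Finset (Fin 6 × Fin 6)).image (fun pq => δ0 pq.1 + δ0 pq.2)).filter (fun w => (∃ p q : Fin 6, δ0 p + δ0 q = w ∧ polar (W c p) (W c q) ≠ 0))
        then (if (∃ p q : Fin 6, δ0 p + δ0 q = w ∧ polar (W c p) (W c q) ≠ 0 ∧ (if p = 5 then 1 else if p = 4 then 1 else 0) + (if q = 5 then 1 else if q = 4 then 1 else 0) = 2) then 2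
          else if (∃ p q : Fin 6, δ0 p + δ0 q = w ∧ polar (W c p) (W c q) ≠ 0 ∧ (if p = 5 then 1 else if p = 4 then 1 else 0) + (if q = 5 then 1 else if q = 4 then 1 else 0) = 1) then 1 else 0) else 0)) ≤ 2 := by
  classical
  set V : Finset ℝ := ((univ : Finset (Fin 6 × Fin 6)).image (fun pq => δ0 pq.1 + δ0 pq.2)) with hV
  -- reading the summand: `= 2` / `= 1` give the corresponding existential
  have hS2 : ∀ (c : Fin C) (w : ℝ), (if w ∈ V.filter (fun w => (∃ p q : Fin 6, δ0 p + δ0 q = w ∧ polar (W c p) (W c q) ≠ 0))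
        then (if (∃ p q : Fin 6, δ0 p + δ0 q = w ∧ polar (W c p) (W c q) ≠ 0 ∧ (if p = 5 then 1 else if p = 4 then 1 else 0) + (if q = 5 then 1 else if q = 4 then 1 else 0) = 2) then 2
          else if (∃ p q : Fin 6, δ0 p + δ0 q = w ∧ polar (W c p) (W c q) ≠ 0 ∧ (if p = 5 then 1 else if p = 4 then 1 else 0) + (if q = 5 then 1 else if q = 4 then 1 else 0) = 1) then 1 else 0) else 0) = 2 →
      ∃ p q : Fin 6, δ0 p + δ0 q = w ∧ polar (W c p) (W c q) ≠ 0 ∧ (if p = 5 then 1 else if p = 4 then 1 else 0) + (if q = 5 then 1 else if q = 4 then 1 else 0) = 2 := by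
    intro c w h
    by_contra hn
    by_cases hmem : w ∈ V.filter (fun w => (∃ p q : Fin 6, δ0 p + δ0 q = w ∧ polar (W c p) (W c q) ≠ 0))
    · rw [if_pos hmem, if_neg hn] at h; split_ifs at h; all_goals omega
    · rw [if_neg hmem] at h; omega
  have hS1' : ∀ (c : Fin C) (w : ℝ), (if w ∈ V.filter (fun w => (∃ p q : Fin 6, δ0 p + δ0 q = w ∧ polar (W c p) (W c q) ≠ 0))
        then (if (∃ p q : Fin 6, δ0 p + δ0 q = w ∧ polar (W c p) (W c q) ≠ 0 ∧ (if p = 5 then 1 else if p = 4 then 1 else 0) + (if q = 5 then 1 else if q = 4 then 1 else 0) = 2) then 2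
          else if (∃ p q : Fin 6, δ0 p + δ0 q = w ∧ polar (W c p) (W c q) ≠ 0 ∧ (if p = 5 then 1 else if p = 4 then 1 else 0) + (if q = 5 then 1 else if q = 4 then 1 else 0) = 1) then 1 else 0) else 0) = 1 →
      ∃ p q : Fin 6, δ0 p + δ0 q = w ∧ polar (W c p) (W c q) ≠ 0 ∧ (if p = 5 then 1 else if p = 4 then 1 else 0) + (if q = 5 then 1 else if q = 4 then 1 else 0) = 1 := by
    intro c w h
    by_contra hn
    by_cases hmem : w ∈ V.filter (fun w => (∃ p q : Fin 6, δ0 p + δ0 q = w ∧ polar (W c p) (W c q) ≠ 0))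
    · rw [if_pos hmem] at h
      by_cases h2 : ∃ p q : Fin 6, δ0 p + δ0 q = w ∧ polar (W c p) (W c q) ≠ 0 ∧ (if p = 5 then 1 else if p = 4 then 1 else 0) + (if q = 5 then 1 else if q = 4 then 1 else 0) = 2
      · rw [if_pos h2] at h; omega
      · rw [if_neg h2, if_neg hn] at h; omega
    · rw [if_neg hmem] at h; omega
  have hSle2 : ∀ (c : Fin C) (w : ℝ), (if w ∈ V.filter (fun w => (∃ p q : Fin 6, δ0 p + δ0 q = w ∧ polar (W c p) (W c q) ≠ 0))
        then (if (∃ p q : Fin 6, δ0 p + δ0 q = w ∧ polar (W c p) (W c q) ≠ 0 ∧ (if p = 5 then 1 else if p = 4 then 1 else 0) + (if q = 5 then 1 else if q = 4 then 1 else 0) = 2) then 2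
          else if (∃ p q : Fin 6, δ0 p + δ0 q = w ∧ polar (W c p) (W c q) ≠ 0 ∧ (if p = 5 then 1 else if p = 4 then 1 else 0) + (if q = 5 then 1 else if q = 4 then 1 else 0) = 1) then 1 else 0) else 0) ≤ 2 := by
    intro c w; split_ifs <;> omega
  have hS0 : ∀ (c : Fin C) (w : ℝ),
      (¬ ∃ p q : Fin 6, δ0 p + δ0 q = w ∧ polar (W c p) (W c q) ≠ 0 ∧ (if p = 5 then 1 else if p = 4 then 1 else 0) + (if q = 5 then 1 else if q = 4 then 1 else 0) = 2) →
      (¬ ∃ p q : Fin 6, δ0 p + δ0 q = w ∧ polar (W c p) (W c q) ≠ 0 ∧ (if p = 5 then 1 else if p = 4 then 1 else 0) + (if q = 5 then 1 else if q = 4 then 1 else 0) = 1) →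
      (if w ∈ V.filter (fun w => (∃ p q : Fin 6, δ0 p + δ0 q = w ∧ polar (W c p) (W c q) ≠ 0))
        then (if (∃ p q : Fin 6, δ0 p + δ0 q = w ∧ polar (W c p) (W c q) ≠ 0 ∧ (if p = 5 then 1 else if p = 4 then 1 else 0) + (if q = 5 then 1 else if q = 4 then 1 else 0) = 2) then 2
          else if (∃ p q : Fin 6, δ0 p + δ0 q = w ∧ polar (W c p) (W c q) ≠ 0 ∧ (if p = 5 then 1 else if p = 4 then 1 else 0) + (if q = 5 then 1 else if q = 4 then 1 else 0) = 1) then 1 else 0) else 0) = 0 := by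
    intro c w h2 h1
    rw [if_neg h2, if_neg h1, ite_self]
  -- the member dictionary (W1 #52a/#52b), instantiated at the alive relation of cluster `c`
  have hAs : ∀ (c : Fin C) (p q : Fin 6), Γ c p q ≠ 0 → Γ c q p ≠ 0 := fun c p q h => by rwa [hΓsymm]
  have dT0_2 : ∀ (c : Fin C) (p q : Fin 6), δ0 p + δ0 q = δ0 0 + δ0 0 → polar (W c p) (W c q) ≠ 0 →
      (if p = 5 then 1 else if p = 4 then 1 else 0) + (if q = 5 then 1 else if q = 4 then 1 else 0) = 2 → Γ c 5 5 ≠ 0 :=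
    fun c p q h1 h2 h3 => twoPair_dict_T0_2 δ0 h50 h41 hG (fun p q => Γ c p q ≠ 0) (hAs c) p q h1 ((hal c p q).mp h2) h3
  have dT0_1 : ∀ (c : Fin C) (p q : Fin 6), δ0 p + δ0 q = δ0 0 + δ0 0 → polar (W c p) (W c q) ≠ 0 →
      (if p = 5 then 1 else if p = 4 then 1 else 0) + (if q = 5 then 1 else if q = 4 then 1 else 0) = 1 → Γ c 0 5 ≠ 0 :=
    fun c p q h1 h2 h3 => twoPair_dict_T0_1 δ0 h50 h41 hG (fun p q => Γ c p q ≠ 0) (hAs c) p q h1 ((hal c p q).mp h2) h3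
  have dT1_2 : ∀ (c : Fin C) (p q : Fin 6), δ0 p + δ0 q = δ0 1 + δ0 1 → polar (W c p) (W c q) ≠ 0 →
      (if p = 5 then 1 else if p = 4 then 1 else 0) + (if q = 5 then 1 else if q = 4 then 1 else 0) = 2 → Γ c 4 4 ≠ 0 :=
    fun c p q h1 h2 h3 => twoPair_dict_T1_2 δ0 h50 h41 hG (fun p q => Γ c p q ≠ 0) (hAs c) p q h1 ((hal c p q).mp h2) h3
  have dT1_1 : ∀ (c : Fin C) (p q : Fin 6), δ0 p + δ0 q = δ0 1 + δ0 1 → polar (W c p) (W c q) ≠ 0 →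
      (if p = 5 then 1 else if p = 4 then 1 else 0) + (if q = 5 then 1 else if q = 4 then 1 else 0) = 1 → Γ c 1 4 ≠ 0 :=
    fun c p q h1 h2 h3 => twoPair_dict_T1_1 δ0 h50 h41 hG (fun p q => Γ c p q ≠ 0) (hAs c) p q h1 ((hal c p q).mp h2) h3
  have dM_2 : ∀ (c : Fin C) (p q : Fin 6), δ0 p + δ0 q = δ0 0 + δ0 1 → polar (W c p) (W c q) ≠ 0 →
      (if p = 5 then 1 else if p = 4 then 1 else 0) + (if q = 5 then 1 else if q = 4 then 1 else 0) = 2 → Γ c 5 4 ≠ 0 :=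
    fun c p q h1 h2 h3 => twoPair_dict_M_2 δ0 h50 h41 hG (fun p q => Γ c p q ≠ 0) (hAs c) p q h1 ((hal c p q).mp h2) h3
  have dM_1 : ∀ (c : Fin C) (p q : Fin 6), δ0 p + δ0 q = δ0 0 + δ0 1 → polar (W c p) (W c q) ≠ 0 →
      (if p = 5 then 1 else if p = 4 then 1 else 0) + (if q = 5 then 1 else if q = 4 then 1 else 0) = 1 → Γ c 0 4 ≠ 0 ∨ Γ c 5 1 ≠ 0 :=
    fun c p q h1 h2 h3 => twoPair_dict_M_1 δ0 h50 h41 hG (fun p q => Γ c p q ≠ 0) (hAs c) p q h1 ((hal c p q).mp h2) h3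
  intro w hw123
  rcases hw123 with hT0 | hT1 | hMx
  · -- the pure class 2δ₀
    subst hT0
    refine sum_le_two_of_rules _ (fun c => hSle2 c _) ?_ ?_
    · intro c c' hcc' hfc
      obtain ⟨p, q, hpq, hpol, hdg⟩ := hS2 c _ hfc
      have h55 : Γ c 5 5 ≠ 0 := dT0_2 c p q hpq hpol hdg
      have hdead : Γ c' 5 5 = 0 ∧ Γ c' 0 5 = 0 := by
        rcases lt_or_gt_of_ne hcc' with hlt | hgt
        · exact Rtop05 c c' hlt h55
        · constructor
          · by_contra h'; exact h55 (Rtop05 c' c hgt h').1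
          · by_contra h'; exact h55 (Rmid05 c' c hgt h')
      refine hS0 c' _ ?_ ?_
      · rintro ⟨p', q', hpq', hpol', hdg'⟩; exact dT0_2 c' p' q' hpq' hpol' hdg' hdead.1
      · rintro ⟨p', q', hpq', hpol', hdg'⟩; exact dT0_1 c' p' q' hpq' hpol' hdg' hdead.2
    · intro c₁ c₂ c₃ h12 h23 hf1 hf2 hf3
      obtain ⟨p₁, q₁, a1, b1, d1⟩ := hS1' c₁ _ hf1
      obtain ⟨p₂, q₂, a2, b2, d2⟩ := hS1' c₂ _ hf2
      obtain ⟨p₃, q₃, a3, b3, d3⟩ := hS1' c₃ _ hf3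
      exact Rthree05 c₁ c₂ c₃ h12 h23 (dT0_1 c₁ p₁ q₁ a1 b1 d1) (dT0_1 c₂ p₂ q₂ a2 b2 d2) (dT0_1 c₃ p₃ q₃ a3 b3 d3)
  · -- the pure class 2δ₁
    subst hT1
    refine sum_le_two_of_rules _ (fun c => hSle2 c _) ?_ ?_
    · intro c c' hcc' hfc
      obtain ⟨p, q, hpq, hpol, hdg⟩ := hS2 c _ hfc
      have h44 : Γ c 4 4 ≠ 0 := dT1_2 c p q hpq hpol hdg
      have hdead : Γ c' 4 4 = 0 ∧ Γ c' 1 4 = 0 := by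
        rcases lt_or_gt_of_ne hcc' with hlt | hgt
        · exact Rtop14 c c' hlt h44
        · constructor
          · by_contra h'; exact h44 (Rtop14 c' c hgt h').1
          · by_contra h'; exact h44 (Rmid14 c' c hgt h')
      refine hS0 c' _ ?_ ?_
      · rintro ⟨p', q', hpq', hpol', hdg'⟩; exact dT1_2 c' p' q' hpq' hpol' hdg' hdead.1
      · rintro ⟨p', q', hpq', hpol', hdg'⟩; exact dT1_1 c' p' q' hpq' hpol' hdg' hdead.2
    · intro c₁ c₂ c₃ h12 h23 hf1 hf2 hf3
      obtain ⟨p₁, q₁, a1, b1, d1⟩ := hS1' c₁ _ hf1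
      obtain ⟨p₂, q₂, a2, b2, d2⟩ := hS1' c₂ _ hf2
      obtain ⟨p₃, q₃, a3, b3, d3⟩ := hS1' c₃ _ hf3
      exact Rthree14 c₁ c₂ c₃ h12 h23 (dT1_1 c₁ p₁ q₁ a1 b1 d1) (dT1_1 c₂ p₂ q₂ a2 b2 d2) (dT1_1 c₃ p₃ q₃ a3 b3 d3)
  · -- the mixed class δ₀+δ₁ (the three input rules)
    subst hMx
    refine sum_le_two_of_rules _ (fun c => hSle2 c _) ?_ ?_
    · intro c c' hcc' hfc
      obtain ⟨p, q, hpq, hpol, hdg⟩ := hS2 c _ hfc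
      have h54 : Γ c 5 4 ≠ 0 := dM_2 c p q hpq hpol hdg
      have hdead : Γ c' 5 4 = 0 ∧ Γ c' 0 4 = 0 ∧ Γ c' 5 1 = 0 := by
        rcases lt_or_gt_of_ne hcc' with hlt | hgt
        · exact Mtop c c' hlt h54
        · refine ⟨?_, ?_, ?_⟩
          · by_contra h'; exact h54 (Mtop c' c hgt h').1
          · by_contra h'; exact h54 (Mmid c' c hgt (Or.inl h'))
          · by_contra h'; exact h54 (Mmid c' c hgt (Or.inr h'))
      refine hS0 c' _ ?_ ?_
      · rintro ⟨p', q', hpq', hpol', hdg'⟩; exact dM_2 c' p' q' hpq' hpol' hdg' hdead.1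
      · rintro ⟨p', q', hpq', hpol', hdg'⟩
        rcases dM_1 c' p' q' hpq' hpol' hdg' with h | h
        · exact h hdead.2.1
        · exact h hdead.2.2
    · intro c₁ c₂ c₃ h12 h23 hf1 hf2 hf3
      obtain ⟨p₁, q₁, a1, b1, d1⟩ := hS1' c₁ _ hf1
      obtain ⟨p₂, q₂, a2, b2, d2⟩ := hS1' c₂ _ hf2
      obtain ⟨p₃, q₃, a3, b3, d3⟩ := hS1' c₃ _ hf3
      exact Mthree c₁ c₂ c₃ h12 h23 (dM_1 c₁ p₁ q₁ a1 b1 d1) (dM_1 c₂ p₂ q₂ a2 b2 d2) (dM_1 c₃ p₃ q₃ a3 b3 d3)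
end Summit.ValiantsHypothesis.ValiantsHypothesis.Theorems.LacunarySymmetroidMatrixDescartes.WallBubbling
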